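import Mathlib
import HarnessLib
import Literature.MathematicalPhysics.QuantumLattice.SectorisedKernelNormExtraction
import Literature.MathematicalPhysics.QuantumLattice.HubbardSpaceTimeCharacters
import Summits.HubbardSuperconductivity.HubbardSuperconductivity.Theorems.KLProgrammeKLRegimeEngineScaleZeroE4Geometry
import Summits.HubbardSuperconductivity.HubbardSuperconductivity.Theorems.KLProgrammeKLRegimeSplitPredicatesV3
import Summits.HubbardSuperconductivity.HubbardSuperconductivity.Theorems.SoloBlindTwistLocalObservables
import Literature.NumberTheory.LFunctions.KloostermanPrimePower
import Literature.NumberTheory.LFunctions.MoebiusWalshKatai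
import Literature.NumberTheory.LFunctions.GaussianHeckeMeanValueLargeSieveProofs

/-!
# Route `KLProgramme` — ENGINE item stmt-HubbardSuperconductivity-20437, class #6 / (E5-F)ₙ producer, route (M) of the (α-0) memo:
# PLANE-WAVE PHASES on the space-time torus, I — the relative phase of one leg is Lipschitz in the momentum, with constant the
# TORUS distance of the two points (brick M4 (ii) of the memo, model-free)

Cell gate-hubbard-kl, seat hubbard-kl-k3c2-p2 (g11; owner-designate of M1 + M3 of route (M), pen (R59az)).  Route (M) («values + per-tuple first
moments ⇒ per-tuple `L¹`», ALPHA0-SCOPING-MEMO §2) reads the momentum-space kernel of `𝒱ₙ[K]` on the whole support box of an iso sector from ONE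
value (the (E5-F) hypothesis at `(ω₀, klBall)`) plus a Lipschitz step whose constant is the pinned FIRST MOMENT of the position kernel (§2.2 of the
memo).  That step is finite Fourier analysis on `SpaceTimeIdx L M = Fin (2M) × (ℤ/L)²` with the cell's plane waves `hubbardPlaneWave β c k x = e^{-i s_c k·x}`
(`SectorisedKernelNorm.lean`); this file supplies its one-leg core, the companion `…EnginePlaneWaveConservation` the conservation/translation layer,
and `…EngineKernelMomentumLipschitz` the kernel statement.

* §1 scalar tools: the one-dimensional character bound in CENTRED representatives `‖χ(a·b) − 1‖ ≤ 2π|ã||b̃|/N` (`norm_stdAddChar_mul_sub_one_le`) and its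
  `(ℤ/L)^d` form `‖χ_q(z) − 1‖ ≤ Σ_b 2π|q̃_b||z̃_b|/L` (`norm_torusChar_sub_one_le`); the dictionary `circDist N a b = |valMinAbs (a − b)|`
  (`circDist_cast_eq_abs_valMinAbs`, `circDist_val_cast_eq_abs_valMinAbs`), `torusAbs (latticeMomentum q b) = 2π|q̃_b|/L` (`torusAbs_latticeMomentum`) and
  `klTorusNorm` in centred form (the generic product/character facts are REUSED from the tree: `GaugeTwist.norm_prod_sub_one_le`, `…Katai.norm_prod_sub_prod_le`,
  `…HeckeMVT.norm_sub_eq_norm_mul_conj_sub_one`, `…LFunctions.norm_stdAddChar`);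
* §2 **relative phases**: `ρ_c(k; x, y) := e^{-is_c k·x}·conj(e^{-is_c k·y})` is the exponential of `−s_c[(ω_k−ω_{k′})(t_x−t_y) + Σ_b (p_b−p′_b)(x̃_b−ỹ_b)]`
  against `ρ_c(k′; x, y)` (`relPhase_mul_conj_relPhase`); its time factor is a character of `ℤ/2M` and each space factor a character of `ℤ/L`, so in
  centred representatives (`norm_cexp_freq_relPhase_sub_one_le`, `norm_cexp_momentum_relPhase_sub_one_le`)
  **`‖ρ_c(k; x, y) − ρ_c(k′; x, y)‖ ≤ |ω_k − ω_{k′}|·ε·circDist_{2M}(x₀,y₀) + Σ_b (2π|valMinAbs(k_b − k′_b)|/L)·circDist_L(x_b,y_b)`** (`norm_relPhase_sub_le`)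
  **`≤ (|ω_k − ω_{k′}| + 2|k⃗ − k⃗′|_𝕋)·spaceTimeDist β x y`** (`norm_relPhase_sub_le_spaceTimeDist`; `0 < β`) — the torus distance of the route's
  `spaceTimeDist`/`fixedTupleL1`/(E4) conventions, not the distance of representatives, is what a momentum step costs.

Everything is proved; no definitions; nothing about the model is asserted.
References: BGM 2006 §2.1 (2.2)–(2.5), §2.7 (2.70) [cite: BenfattoGiulianiMastropietro2006]; Salmhofer 1999 §4.2.4 (4.55)–(4.63), App. B.5.5 [cite: Salmhofer1999].
-/

noncomputable section

namespace Summit.HubbardSuperconductivity.HubbardSuperconductivity.Theorems.EngineV8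

set_option linter.dupNamespace false -- summit = problem name (single-conjunct summit), D-0017

open Classical
open Real Finset Complex Literature.MathematicalPhysics.QuantumLattice Literature.Probability.LatticeModels GrassmannAlgebra
open Summit.HubbardSuperconductivity.HubbardSuperconductivity.Theorems.KLProgrammeLegKernels
open Summit.HubbardSuperconductivity.HubbardSuperconductivity.Theorems.KLRegimeSplit
open scoped ComplexConjugate
/-! ## §1 Scalar tools -/

section Scalar

/-! Reused from the tree (not restated): `GaugeTwist.norm_prod_sub_one_le` (`‖∏f − 1‖ ≤ Σ‖f − 1‖`), `Literature.NumberTheory.LFunctions.Katai.norm_prod_sub_prod_le`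
(`‖∏f − ∏g‖ ≤ Σ‖f − g‖`), `Literature.NumberTheory.LFunctions.GaussianInt.HeckeMVT.norm_sub_eq_norm_mul_conj_sub_one` (`‖a − b‖ = ‖a·conj b − 1‖`, `‖b‖ = 1`),
`Literature.NumberTheory.LFunctions.norm_stdAddChar` (characters are unimodular) — all for factors of norm `≤ 1`. -/

/-- **The one-dimensional character bound in centred representatives**: `‖χ(a·b) − 1‖ ≤ 2π·|ã|·|b̃|/N`
(`χ = ZMod.stdAddChar`, `ã = valMinAbs a`). -/
theorem norm_stdAddChar_mul_sub_one_le {N : ℕ} [NeZero N] (a b : ZMod N) :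
    ‖(ZMod.stdAddChar (a * b) : ℂ) - 1‖ ≤ 2 * π * |(a.valMinAbs : ℝ)| * |(b.valMinAbs : ℝ)| / N := by
  have hab : a * b = (((a.valMinAbs * b.valMinAbs : ℤ)) : ZMod N) := by
    rw [Int.cast_mul, ZMod.coe_valMinAbs, ZMod.coe_valMinAbs]
  rw [hab, ZMod.stdAddChar_coe]
  have hre : (2 * (π : ℂ) * I * ((a.valMinAbs * b.valMinAbs : ℤ) : ℂ) / (N : ℂ)) =
      I * ((2 * π * ((a.valMinAbs : ℝ) * (b.valMinAbs : ℝ)) / N : ℝ) : ℂ) := by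
    push_cast
    ring
  rw [hre]
  refine Real.norm_exp_I_mul_ofReal_sub_one_le.trans (le_of_eq ?_)
  rw [Real.norm_eq_abs, abs_div, Nat.abs_cast, abs_mul, abs_mul, abs_mul, abs_of_pos Real.pi_pos, abs_two]
  ring

/-- **The `d`-dimensional character bound**: `‖χ_q(z) − 1‖ ≤ Σ_b 2π·|q̃_b|·|z̃_b|/L` (centred representatives). -/
theorem norm_torusChar_sub_one_le {d L : ℕ} [NeZero L] (q z : TorusSite d L) :
    ‖torusChar q z - 1‖ ≤ ∑ b, 2 * π * |((q b).valMinAbs : ℝ)| * |((z b).valMinAbs : ℝ)| / L := by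
  rw [torusChar]
  refine (GaugeTwist.norm_prod_sub_one_le _ _ fun b _ => (Literature.NumberTheory.LFunctions.norm_stdAddChar _).le).trans ?_
  exact sum_le_sum fun b _ => norm_stdAddChar_mul_sub_one_le (q b) (z b)

/-- `|valMinAbs (−z)| = |valMinAbs z|` (as real numbers). -/
theorem abs_cast_valMinAbs_neg {N : ℕ} (z : ZMod N) : |(((-z).valMinAbs : ℤ) : ℝ)| = |((z.valMinAbs : ℤ) : ℝ)| := by
  rw [← Int.cast_abs, ← Int.cast_abs, Int.abs_eq_natAbs, Int.abs_eq_natAbs, ZMod.natAbs_valMinAbs_neg]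

/-- **The route's circular distance is the centred absolute value**: `(circDist N a b : ℝ) = |valMinAbs ((a : ℤ/N) − b)|`. -/
theorem circDist_cast_eq_abs_valMinAbs (N a b : ℕ) [NeZero N] :
    (circDist N a b : ℝ) = |((((a : ZMod N) - (b : ZMod N)).valMinAbs : ℤ) : ℝ)| := by
  rw [circDist_eq_cyclicDist, cyclicDist, ← ZMod.valMinAbs_natAbs_eq_min, Nat.cast_natAbs, Int.cast_abs]

/-- The circular distance of torus coordinates: `circDist L (u.val) (v.val) = |valMinAbs (u − v)|`. -/
theorem circDist_val_cast_eq_abs_valMinAbs {L : ℕ} [NeZero L] (u v : ZMod L) :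
    (circDist L u.val v.val : ℝ) = |(((u - v).valMinAbs : ℤ) : ℝ)| := by
  rw [circDist_cast_eq_abs_valMinAbs, ZMod.natCast_zmod_val, ZMod.natCast_zmod_val]

/-- The circular distance is symmetric. -/
theorem circDist_comm (N a b : ℕ) : circDist N a b = circDist N b a := by
  unfold circDist; exact min_comm _ _

/-- **`torusAbs` of a lattice momentum in centred form**: `|p_{q,b}|_𝕋 = 2π|q̃_b|/L`. -/
theorem torusAbs_latticeMomentum {d L : ℕ} [NeZero L] (q : TorusSite d L) (b : Fin d) :
    torusAbs (latticeMomentum L q b) = 2 * π * |((q b).valMinAbs : ℝ)| / L := by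
  have hL : (0 : ℝ) < L := Nat.cast_pos.2 (Nat.pos_of_ne_zero (NeZero.ne L))
  -- `p = 2π val/L = 2π ṽ/L + 2π j`, `j ∈ ℤ`
  have hdvd : (L : ℤ) ∣ ((q b).val : ℤ) - (q b).valMinAbs := by
    rw [← ZMod.intCast_zmod_eq_zero_iff_dvd]; push_cast; simp
  obtain ⟨j, hj⟩ := hdvd
  have hval : ((q b).val : ℝ) = ((q b).valMinAbs : ℝ) + (L : ℝ) * (j : ℝ) := by
    have := congrArg (fun z : ℤ => (z : ℝ)) hj; push_cast at this; linarith
  have hp : latticeMomentum L q b = 2 * π * ((q b).valMinAbs : ℝ) / L + j • (2 * π) := by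
    unfold latticeMomentum
    rw [hval, zsmul_eq_mul]
    field_simp
  -- the centred representative lies in `(-π, π]`
  have hmem : 2 * π * ((q b).valMinAbs : ℝ) / L ∈ Set.Ioc (-π) (-π + 2 * π) := by
    have h2 := ZMod.valMinAbs_mem_Ioc (q b)
    have hlo : (-(L : ℝ)) < ((q b).valMinAbs : ℝ) * 2 := by exact_mod_cast h2.1
    have hhi : ((q b).valMinAbs : ℝ) * 2 ≤ L := by exact_mod_cast h2.2
    constructor
    · rw [lt_div_iff₀ hL]; nlinarith [Real.pi_pos]
    · rw [div_le_iff₀ hL]; nlinarith [Real.pi_pos]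
  unfold torusAbs
  rw [hp, toIocMod_add_zsmul, (toIocMod_eq_self Real.two_pi_pos).2 hmem, abs_div, abs_mul, abs_of_pos Real.two_pi_pos,
    Nat.abs_cast]

/-- **`klTorusNorm` in centred form**: `|k⃗|_𝕋 = max_b 2π|k̃_b|/L`. -/
theorem klTorusNorm_eq_max {L : ℕ} [NeZero L] (q : TorusSite 2 L) :
    klTorusNorm L q = max (2 * π * |((q 0).valMinAbs : ℝ)| / L) (2 * π * |((q 1).valMinAbs : ℝ)| / L) := by
  rw [klTorusNorm, torusSupNorm, torusAbs_latticeMomentum, torusAbs_latticeMomentum]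

/-- Each centred coordinate momentum is below `klTorusNorm`. -/
theorem two_pi_mul_abs_valMinAbs_div_le_klTorusNorm {L : ℕ} [NeZero L] (q : TorusSite 2 L) (b : Fin 2) :
    2 * π * |((q b).valMinAbs : ℝ)| / L ≤ klTorusNorm L q := by
  rw [klTorusNorm_eq_max]
  fin_cases b
  · exact le_max_left _ _
  · exact le_max_right _ _

end Scalar

/-! ## §2 Relative phases of one leg -/

section RelPhase

variable {L M : ℕ} [NeZero L]

/-- The integer charge sign `s_c ∈ {1, −1}` behind `chargeSign`. -/
theorem chargeSign_eq_intCast (c : Fin 2) : chargeSign c = ((if c = 0 then (1 : ℤ) else -1 : ℤ) : ℝ) := by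
  unfold chargeSign; split_ifs <;> simp

/-- `|s_c| = 1` on the integers. -/
theorem natAbs_chargeSignInt (c : Fin 2) : (if c = 0 then (1 : ℤ) else -1 : ℤ).natAbs = 1 := by
  split_ifs <;> simp

omit [NeZero L] in
/-- **One leg at two points**: `e^{-is_c k·x}·conj(e^{-is_c k·y}) = exp(−i s_c (k·x − k·y))`. -/
theorem hubbardPlaneWave_mul_conj (β : ℝ) (c : Fin 2) (k : FreqMomentum L M) (x y : SpaceTimeIdx L M) :
    hubbardPlaneWave L M β c k x * conj (hubbardPlaneWave L M β c k y) =
      Complex.exp (((-(chargeSign c * (spaceTimePhase L M β k x - spaceTimePhase L M β k y)) : ℝ) : ℂ) * I) := by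
  unfold hubbardPlaneWave
  rw [← Complex.exp_conj, map_mul, Complex.conj_I, map_neg, Complex.conj_ofReal, ← Complex.exp_add]
  congr 1
  push_cast
  ring

omit [NeZero L] in
/-- **The relative phase of one leg for two momenta** is the exponential of
`−s_c·[(ω_k − ω_{k′})(t_x − t_y) + Σ_b (p_{k,b} − p_{k′,b})(x̃_b − ỹ_b)]` (representatives in `[0, β) × [0, L)²`). -/
theorem relPhase_mul_conj_relPhase (β : ℝ) (c : Fin 2) (k k' : FreqMomentum L M) (x y : SpaceTimeIdx L M) :
    hubbardPlaneWave L M β c k x * conj (hubbardPlaneWave L M β c k y) *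
        conj (hubbardPlaneWave L M β c k' x * conj (hubbardPlaneWave L M β c k' y)) =
      Complex.exp (((-(chargeSign c *
        ((matsubaraFreq β M k.1 - matsubaraFreq β M k'.1) * (imagTime β M x.1 - imagTime β M y.1) +
          ∑ b, (latticeMomentum L k.2 b - latticeMomentum L k'.2 b) * (((x.2 b).val : ℝ) - ((y.2 b).val : ℝ)))) : ℝ) : ℂ) * I) := by
  rw [hubbardPlaneWave_mul_conj, hubbardPlaneWave_mul_conj, ← Complex.exp_conj, map_mul, Complex.conj_I, Complex.conj_ofReal,
    ← Complex.exp_add]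
  congr 1
  simp only [spaceTimePhase, Fin.sum_univ_two]
  push_cast
  ring

/-- `exp(2πi z/N) = χ(z mod N)` read backwards (`ZMod.stdAddChar_coe`). -/
theorem cexp_two_pi_mul_intCast_div (N : ℕ) [NeZero N] (z : ℤ) :
    Complex.exp (((2 * π * (z : ℝ) / N : ℝ) : ℂ) * I) = (ZMod.stdAddChar ((z : ZMod N)) : ℂ) := by
  rw [ZMod.stdAddChar_coe]
  congr 1
  push_cast
  ring

/-- The centred representative of an integer is not longer than the integer: `|valMinAbs (z mod N)| ≤ |z|`. -/
theorem abs_valMinAbs_intCast_le (N : ℕ) [NeZero N] (z : ℤ) : |(((z : ZMod N).valMinAbs : ℤ) : ℝ)| ≤ |(z : ℝ)| := by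
  have h := ZMod.natAbs_min_of_le_div_two N ((z : ZMod N).valMinAbs) z (by rw [ZMod.coe_valMinAbs]) (ZMod.natAbs_valMinAbs_le _)
  rw [← Int.cast_abs, ← Int.cast_abs, Int.cast_le, Int.abs_eq_natAbs, Int.abs_eq_natAbs]
  exact_mod_cast h

omit [NeZero L] in
/-- **TIME PART**: `‖exp(−is(ω_k − ω_{k′})(t_x − t_y) I) − 1‖ ≤ |ω_k − ω_{k′}|·ε·circDist_{2M}(x₀, y₀)` (`0 < β`, `ε = β/(2M)`): the phase is the
character `χ_{n−n′}(x₀ − y₀)` of `ℤ/2M`, whose distance to `1` is read in CENTRED representatives. -/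
theorem norm_cexp_freq_relPhase_sub_one_le [NeZero M] {β : ℝ} (hβ : 0 < β) (c : Fin 2) (k k' : FreqMomentum L M) (x y : SpaceTimeIdx L M) :
    ‖Complex.exp (((-(chargeSign c * ((matsubaraFreq β M k.1 - matsubaraFreq β M k'.1) * (imagTime β M x.1 - imagTime β M y.1))) : ℝ) : ℂ) * I) - 1‖ ≤
      |matsubaraFreq β M k.1 - matsubaraFreq β M k'.1| * (imagTimeWeight β M * (circDist (2 * M) x.1.val y.1.val : ℝ)) := by
  haveI : NeZero (2 * M) := ⟨by have := NeZero.ne M; omega⟩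
  have hM : (0 : ℝ) < M := Nat.cast_pos.2 (Nat.pos_of_ne_zero (NeZero.ne M))
  set s : ℤ := if c = 0 then (1 : ℤ) else -1 with hs
  set dn : ℤ := matsubaraInt M k.1 - matsubaraInt M k'.1 with hdn
  set dj : ℤ := ((x.1 : ℕ) : ℤ) - ((y.1 : ℕ) : ℤ) with hdj
  -- the phase is `2π z/(2M)` with the integer `z = -s·dn·dj`
  have hphase : -(chargeSign c * ((matsubaraFreq β M k.1 - matsubaraFreq β M k'.1) * (imagTime β M x.1 - imagTime β M y.1))) =
      2 * π * (((-s * dn * dj : ℤ)) : ℝ) / ((2 * M : ℕ) : ℝ) := by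
    rw [chargeSign_eq_intCast, ← hs, hdn, hdj]
    simp only [matsubaraFreq, imagTime]
    push_cast
    field_simp
    ring
  rw [hphase, cexp_two_pi_mul_intCast_div]
  have hcast : (((-s * dn * dj : ℤ)) : ZMod (2 * M)) = (((-s * dn : ℤ)) : ZMod (2 * M)) * ((((x.1 : ℕ) : ZMod (2 * M))) - (((y.1 : ℕ) : ZMod (2 * M)))) := by
    rw [hdj]; push_cast; ring
  rw [hcast]
  refine (norm_stdAddChar_mul_sub_one_le _ _).trans ?_
  -- centred representatives: `|ṽ| ≤ |s·dn| = |dn|`, `|z̃| = circDist`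
  have h1 : |(((((-s * dn : ℤ)) : ZMod (2 * M)).valMinAbs : ℤ) : ℝ)| ≤ |(dn : ℝ)| := by
    refine (abs_valMinAbs_intCast_le (2 * M) (-s * dn)).trans (le_of_eq ?_)
    rw [Int.cast_mul, abs_mul, Int.cast_neg, abs_neg, ← Int.cast_abs, Int.abs_eq_natAbs, hs, natAbs_chargeSignInt]
    simp
  have h2 : |((((((x.1 : ℕ) : ZMod (2 * M))) - (((y.1 : ℕ) : ZMod (2 * M)))).valMinAbs : ℤ) : ℝ)| = (circDist (2 * M) x.1.val y.1.val : ℝ) :=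
    (circDist_cast_eq_abs_valMinAbs (2 * M) x.1.val y.1.val).symm
  have hω : |matsubaraFreq β M k.1 - matsubaraFreq β M k'.1| = 2 * π * |(dn : ℝ)| / β := by
    rw [hdn]
    simp only [matsubaraFreq]
    rw [← sub_div, abs_div, abs_of_pos hβ]
    congr 1
    rw [show π * (2 * (matsubaraInt M k.1 : ℝ) + 1) - π * (2 * (matsubaraInt M k'.1 : ℝ) + 1) =
      2 * π * ((matsubaraInt M k.1 : ℝ) - (matsubaraInt M k'.1 : ℝ)) by ring, abs_mul, abs_of_pos Real.two_pi_pos]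
    push_cast
    ring
  rw [h2, hω, imagTimeWeight]
  have hcd : (0 : ℝ) ≤ (circDist (2 * M) x.1.val y.1.val : ℝ) := Nat.cast_nonneg _
  calc 2 * π * |(((((-s * dn : ℤ)) : ZMod (2 * M)).valMinAbs : ℤ) : ℝ)| * (circDist (2 * M) x.1.val y.1.val : ℝ) / ((2 * M : ℕ) : ℝ)
      ≤ 2 * π * |(dn : ℝ)| * (circDist (2 * M) x.1.val y.1.val : ℝ) / ((2 * M : ℕ) : ℝ) := by
        gcongr
    _ = 2 * π * |(dn : ℝ)| / β * (β / (2 * M) * (circDist (2 * M) x.1.val y.1.val : ℝ)) := by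
        push_cast
        field_simp

/-- **SPACE PART**, coordinate `b`: `‖exp(−is(p_{k,b} − p_{k′,b})(x̃_b − ỹ_b) I) − 1‖ ≤ (2π|valMinAbs (k_b − k′_b)|/L)·circDist_L(x_b, y_b)`. -/
theorem norm_cexp_momentum_relPhase_sub_one_le (c : Fin 2) (q q' : TorusSite 2 L) (u v : TorusSite 2 L) (b : Fin 2) :
    ‖Complex.exp (((-(chargeSign c * ((latticeMomentum L q b - latticeMomentum L q' b) * (((u b).val : ℝ) - ((v b).val : ℝ)))) : ℝ) : ℂ) * I) - 1‖ ≤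
      2 * π * |(((q - q') b).valMinAbs : ℝ)| / L * (circDist L (u b).val (v b).val : ℝ) := by
  have hL : (0 : ℝ) < L := Nat.cast_pos.2 (Nat.pos_of_ne_zero (NeZero.ne L))
  set s : ℤ := if c = 0 then (1 : ℤ) else -1 with hs
  set dk : ℤ := (((q b).val : ℕ) : ℤ) - (((q' b).val : ℕ) : ℤ) with hdk
  set dx : ℤ := (((u b).val : ℕ) : ℤ) - (((v b).val : ℕ) : ℤ) with hdx
  have hphase : -(chargeSign c * ((latticeMomentum L q b - latticeMomentum L q' b) * (((u b).val : ℝ) - ((v b).val : ℝ)))) =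
      2 * π * (((-s * dk * dx : ℤ)) : ℝ) / (L : ℝ) := by
    rw [chargeSign_eq_intCast, ← hs, hdk, hdx]
    simp only [latticeMomentum]
    push_cast
    field_simp
  rw [hphase, cexp_two_pi_mul_intCast_div]
  have hcast : (((-s * dk * dx : ℤ)) : ZMod L) = (((-s : ℤ) : ZMod L) * (q - q') b) * (u b - v b) := by
    rw [hdk, hdx]
    push_cast
    rw [ZMod.natCast_zmod_val, ZMod.natCast_zmod_val, ZMod.natCast_zmod_val, ZMod.natCast_zmod_val, Pi.sub_apply]
  rw [hcast]
  refine (norm_stdAddChar_mul_sub_one_le _ _).trans (le_of_eq ?_)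
  -- `|valMinAbs (±q)| = |valMinAbs q|`, `|valMinAbs (u_b − v_b)| = circDist`
  have h1 : |(((((-s : ℤ) : ZMod L) * (q - q') b).valMinAbs : ℤ) : ℝ)| = |(((q - q') b).valMinAbs : ℝ)| := by
    rw [hs]
    split_ifs
    · have h' : (((-(1 : ℤ) : ℤ)) : ZMod L) * (q - q') b = -((q - q') b) := by push_cast; ring
      rw [h', abs_cast_valMinAbs_neg]
    · have h' : (((-(-1 : ℤ) : ℤ)) : ZMod L) * (q - q') b = (q - q') b := by push_cast; ring
      rw [h']
  rw [h1, ← circDist_val_cast_eq_abs_valMinAbs]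
  ring

/-- **THE RELATIVE PHASE OF ONE LEG IS LIPSCHITZ IN THE MOMENTUM, with constant the torus distance of the two points** (`0 < β`):
`‖ρ_c(k; x, y) − ρ_c(k′; x, y)‖ ≤ |ω_k − ω_{k′}|·ε·circDist_{2M}(x₀,y₀) + Σ_b (2π|valMinAbs(k_b − k′_b)|/L)·circDist_L(x_b, y_b)`,
`ρ_c(k; x, y) = e^{-is_c k·x}·conj(e^{-is_c k·y})`. -/
theorem norm_relPhase_sub_le [NeZero M] {β : ℝ} (hβ : 0 < β) (c : Fin 2) (k k' : FreqMomentum L M) (x y : SpaceTimeIdx L M) :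
    ‖hubbardPlaneWave L M β c k x * conj (hubbardPlaneWave L M β c k y) -
        hubbardPlaneWave L M β c k' x * conj (hubbardPlaneWave L M β c k' y)‖ ≤
      |matsubaraFreq β M k.1 - matsubaraFreq β M k'.1| * (imagTimeWeight β M * (circDist (2 * M) x.1.val y.1.val : ℝ)) +
        ∑ b, 2 * π * |(((k.2 - k'.2) b).valMinAbs : ℝ)| / L * (circDist L (x.2 b).val (y.2 b).val : ℝ) := by
  have hunit : ‖hubbardPlaneWave L M β c k' x * conj (hubbardPlaneWave L M β c k' y)‖ = 1 := by
    rw [norm_mul, Complex.norm_conj, norm_hubbardPlaneWave, norm_hubbardPlaneWave, mul_one]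
  rw [Literature.NumberTheory.LFunctions.GaussianInt.HeckeMVT.norm_sub_eq_norm_mul_conj_sub_one _ hunit, relPhase_mul_conj_relPhase]
  -- split the exponential into the time factor and the two space factors
  have hsplit : ∀ (T S₀ S₁ : ℝ), Complex.exp (((-(chargeSign c * (T + (S₀ + S₁)))) : ℝ) * I) =
      Complex.exp (((-(chargeSign c * T)) : ℝ) * I) * (Complex.exp (((-(chargeSign c * S₀)) : ℝ) * I) * Complex.exp (((-(chargeSign c * S₁)) : ℝ) * I)) := by
    intro T S₀ S₁
    rw [← Complex.exp_add, ← Complex.exp_add]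
    congr 1; push_cast; ring
  rw [Fin.sum_univ_two, hsplit, Fin.sum_univ_two]
  have hu : ∀ r : ℝ, ‖Complex.exp (((r : ℝ) : ℂ) * I)‖ ≤ 1 := fun r => (Complex.norm_exp_ofReal_mul_I r).le
  -- `‖a·b − 1‖ ≤ ‖a − 1‖ + ‖b − 1‖` for `‖a‖ ≤ 1` (`ab − 1 = a(b − 1) + (a − 1)`)
  have hms : ∀ a b : ℂ, ‖a‖ ≤ 1 → ‖a * b - 1‖ ≤ ‖a - 1‖ + ‖b - 1‖ := fun a b ha => by
    rw [show a * b - 1 = a * (b - 1) + (a - 1) by ring]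
    refine (norm_add_le _ _).trans ?_
    rw [add_comm, norm_mul]
    exact add_le_add le_rfl ((mul_le_mul_of_nonneg_right ha (norm_nonneg _)).trans (one_mul _).le)
  refine (hms _ _ (hu _)).trans (add_le_add (norm_cexp_freq_relPhase_sub_one_le hβ c k k' x y) ?_)
  exact (hms _ _ (hu _)).trans (add_le_add (norm_cexp_momentum_relPhase_sub_one_le c k.2 k'.2 x.2 y.2 0)
    (norm_cexp_momentum_relPhase_sub_one_le c k.2 k'.2 x.2 y.2 1))

/-- **The same against the route's `spaceTimeDist`** (sup of the time distance and the two coordinate distances) and `klTorusNorm`: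
`‖ρ_c(k; x, y) − ρ_c(k′; x, y)‖ ≤ (|ω_k − ω_{k′}| + 2·|k⃗ − k⃗′|_𝕋)·spaceTimeDist β x y`. -/
theorem norm_relPhase_sub_le_spaceTimeDist [NeZero M] {β : ℝ} (hβ : 0 < β) (c : Fin 2) (k k' : FreqMomentum L M) (x y : SpaceTimeIdx L M) :
    ‖hubbardPlaneWave L M β c k x * conj (hubbardPlaneWave L M β c k y) -
        hubbardPlaneWave L M β c k' x * conj (hubbardPlaneWave L M β c k' y)‖ ≤
      (|matsubaraFreq β M k.1 - matsubaraFreq β M k'.1| + 2 * klTorusNorm L (k.2 - k'.2)) * spaceTimeDist L M β x y := by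
  refine (norm_relPhase_sub_le hβ c k k' x y).trans ?_
  have hd0 : 0 ≤ spaceTimeDist L M β x y := by
    unfold KLRegimeSplit.spaceTimeDist; exact le_max_of_le_right (le_max_of_le_left (Nat.cast_nonneg _))
  have ht : imagTimeWeight β M * (circDist (2 * M) x.1.val y.1.val : ℝ) ≤ spaceTimeDist L M β x y := le_max_left _ _
  have hx : ∀ b : Fin 2, (circDist L (x.2 b).val (y.2 b).val : ℝ) ≤ spaceTimeDist L M β x y := by
    intro b
    unfold KLRegimeSplit.spaceTimeDist
    fin_cases b
    · exact le_max_of_le_right (le_max_left _ _)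
    · exact le_max_of_le_right (le_max_right _ _)
  have hq : ∀ b : Fin 2, 2 * π * |(((k.2 - k'.2) b).valMinAbs : ℝ)| / L ≤ klTorusNorm L (k.2 - k'.2) := fun b =>
    two_pi_mul_abs_valMinAbs_div_le_klTorusNorm _ b
  have hq0 : ∀ b : Fin 2, 0 ≤ 2 * π * |(((k.2 - k'.2) b).valMinAbs : ℝ)| / L := fun b => by positivity
  have hA0 := mul_le_mul (hq 0) (hx 0) (Nat.cast_nonneg _) ((hq0 0).trans (hq 0))
  have hA1 := mul_le_mul (hq 1) (hx 1) (Nat.cast_nonneg _) ((hq0 1).trans (hq 1))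
  have hT := mul_le_mul_of_nonneg_left ht (abs_nonneg (matsubaraFreq β M k.1 - matsubaraFreq β M k'.1))
  rw [Fin.sum_univ_two]
  linarith

end RelPhase


end Summit.HubbardSuperconductivity.HubbardSuperconductivity.Theorems.EngineV8

end
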